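import Literature.AnabelianGeometry.SemiGraphs.CoveringHomCanonical

/-!
# The two presentations of the covering `𝒢_A → 𝒢` coincide ([SemiAnbd] Def. 2.2 (i))

Mochizuki, *Semi-graphs of anabelioids*, Publ. RIMS **42** (2006) 221–322, §2 p. 23
[cite: MochizukiSemiAnbd2006, Def. 2.2(i) p.23].  `CoveringOfObject.lean` (abc-iut-L3-t5) builds the
covering `coveringHom A : 𝒢_A → 𝒢` attached to an object `A` of `B(𝒢)` with 2-cells `twoIso` whose core
`gluingStarIso` passes through Mathlib's composite `Over.starPullbackIsoStar`; `CoveringHomCanonical.lean`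
builds the variant `coveringHomCan A` with the same base and vertex/edge components and 2-cells
`twoIsoCan` on the explicit pull-back comparison `gluingStarIsoCan` (needed to COMPUTE with the 2-cells:
the global clause `B(𝒢_A) ≃ B(𝒢)_{/A}`).  This proof-only file shows the two 2-cells are EQUAL, hence
**`coveringHomCan A = coveringHom A`**: every fact proved for one presentation (global clause for
`coveringHomCan`; branch/vertex alignment for `coveringHom`) holds verbatim for the other.

* `gluingStarIso_hom_app_left_snd` — the second projection of Mathlib's composite comparison
  `b^*(P × X) ×_{b^* P} Q ⥲ Q × b^* X` is `pr₁ ≫ b^* pr₂`, like the canonical one;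
* `gluingStarIso_eq_gluingStarIsoCan`, `twoIso_eq_twoIsoCan`, `coveringHomCan_eq_coveringHom`.
-/

namespace Literature.AnabelianGeometry.SemiGraphs

namespace SemiGraphOfAnabelioids

open CategoryTheory CategoryTheory.Limits CategoryTheory.PreGaloisCategory
open Literature.AnabelianGeometry.Anabelioids

universe v₁ u₁ u

-- Mathlib's `Over.pullback` / `Over.star` simp lemmas (`pullback.lift_fst`, …) only fire under the
-- pre-v4.2x defeq transparency behaviour, exactly as in `Mathlib/CategoryTheory/Comma/Over/Pullback.lean`.
set_option backward.isDefEq.respectTransparency false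

/-- The second projection of Mathlib's `Over.starPullbackIsoStar f` at `Z`: `(Y × Z) ×_Y X ⥲ X × Z`
followed by `pr₂` is `pr₁ ≫ pr₂`. [cite: MochizukiSemiAnbd2006, Def. 2.2(i) p.23] -/
theorem Over.starPullbackIsoStar_hom_app_left_snd {C : Type*} [Category C] [HasBinaryProducts C]
    [HasPullbacks C] {X Y : C} (f : X ⟶ Y) (Z : C) :
    ((Over.starPullbackIsoStar f).hom.app Z).left ≫ Limits.prod.snd =
      pullback.fst _ _ ≫ (Limits.prod.snd : Y ⨯ Z ⟶ Z) := by
  simp [Over.starPullbackIsoStar, pullback.congrHom]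

/-- The first projection of Mathlib's `Over.starPullbackIsoStar f` at `Z`: `(Y × Z) ×_Y X ⥲ X × Z`
followed by `pr₁` is `pr₂` (the projection to `X`). [cite: MochizukiSemiAnbd2006, Def. 2.2(i) p.23] -/
theorem Over.starPullbackIsoStar_hom_app_left_fst {C : Type*} [Category C] [HasBinaryProducts C]
    [HasPullbacks C] {X Y : C} (f : X ⟶ Y) (Z : C) :
    ((Over.starPullbackIsoStar f).hom.app Z).left ≫ Limits.prod.fst = pullback.snd _ _ := by
  simp [Over.starPullbackIsoStar, pullback.congrHom]

namespace BObj

variable {𝒢 : SemiGraphOfAnabelioids.{v₁, u₁, u}} (A : 𝒢.BObj)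

/-- The first projection of the Mathlib-composite comparison `gluingStarIso`: to `Q` it is the second
projection of `b^*(P × X) ×_{b^* P} Q`. [cite: MochizukiSemiAnbd2006, Def. 2.2(i) p.23] -/
theorem gluingStarIso_hom_app_left_fst {b : 𝒢.graph.Branch} {v : 𝒢.graph.Vertex}
    (h : 𝒢.graph.abuts b = some v) (P : Subobject (A.S v)) (Q : Subobject (A.T (𝒢.graph.edgeOf b)))
    (hle : Q ≤ A.branchImage b v h P) (X : 𝒢.V v) :
    ((A.gluingStarIso h P Q hle).hom.app X).left ≫ Limits.prod.fst = pullback.snd _ _ := by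
  haveI : PreservesFiniteLimits (𝒢.pull b v h).pullback := (𝒢.pull b v h).property.1
  rw [gluingStarIso]
  simp only [Iso.trans_hom, NatTrans.comp_app, Functor.isoWhiskerRight_hom, Functor.whiskerRight_app,
    Functor.isoWhiskerLeft_hom, Functor.whiskerLeft_app, Over.comp_left, Category.assoc]
  erw [Over.starPullbackIsoStar_hom_app_left_fst]
  have hm : ((Over.pullback (A.inclOfLE h P Q hle)).map
      ((starPostIso (𝒢.pull b v h).pullback (P : 𝒢.V v)).hom.app X)).left ≫ pullback.snd _ _ =
      pullback.snd _ _ := by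
    simp [Over.pullback_map_left]
  erw [hm]
  rfl

/-- The second projection of the Mathlib-composite comparison `gluingStarIso`:
`b^*(P × X) ×_{b^* P} Q ⥲ Q × b^* X` followed by `pr₂` is `pr₁ ≫ b^* pr₂` — as for the canonical
`gluingStarIsoCan` (`gluingStarIsoCan_hom_app_left_snd`). [cite: MochizukiSemiAnbd2006, Def. 2.2(i) p.23] -/
theorem gluingStarIso_hom_app_left_snd {b : 𝒢.graph.Branch} {v : 𝒢.graph.Vertex}
    (h : 𝒢.graph.abuts b = some v) (P : Subobject (A.S v)) (Q : Subobject (A.T (𝒢.graph.edgeOf b)))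
    (hle : Q ≤ A.branchImage b v h P) (X : 𝒢.V v) :
    ((A.gluingStarIso h P Q hle).hom.app X).left ≫ Limits.prod.snd =
      pullback.fst _ _ ≫ (𝒢.pull b v h).pullback.map (Limits.prod.snd : (P : 𝒢.V v) ⨯ X ⟶ X) := by
  haveI : PreservesFiniteLimits (𝒢.pull b v h).pullback := (𝒢.pull b v h).property.1
  rw [gluingStarIso]
  simp only [Iso.trans_hom, NatTrans.comp_app, Functor.isoWhiskerRight_hom, Functor.whiskerRight_app,
    Functor.isoWhiskerLeft_hom, Functor.whiskerLeft_app, Over.comp_left, Category.assoc]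
  erw [Over.starPullbackIsoStar_hom_app_left_snd]
  have hm : ((Over.pullback (A.inclOfLE h P Q hle)).map
      ((starPostIso (𝒢.pull b v h).pullback (P : 𝒢.V v)).hom.app X)).left ≫ pullback.fst _ _ =
      pullback.fst _ _ ≫ ((starPostIso (𝒢.pull b v h).pullback (P : 𝒢.V v)).hom.app X).left := by
    simp [Over.pullback_map_left]
  erw [reassoc_of% hm]
  erw [starPostIso_hom_app_left, prodComparison_snd]
  rfl

/-- **The Mathlib-composite and the canonical comparison agree**: `gluingStarIso = gluingStarIsoCan`
(both are morphisms over `Q` into `Q × b^* X`, so they are determined by their second projections).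
[cite: MochizukiSemiAnbd2006, Def. 2.2(i) p.23] -/
theorem gluingStarIso_eq_gluingStarIsoCan {b : 𝒢.graph.Branch} {v : 𝒢.graph.Vertex}
    (h : 𝒢.graph.abuts b = some v) (P : Subobject (A.S v)) (Q : Subobject (A.T (𝒢.graph.edgeOf b)))
    (hle : Q ≤ A.branchImage b v h P) :
    A.gluingStarIso h P Q hle = A.gluingStarIsoCan h P Q hle := by
  ext X : 3
  apply Over.OverMorphism.ext
  apply Limits.prod.hom_ext
  · erw [gluingStarIso_hom_app_left_fst, gluingStarIsoCan_hom_app_left_fst]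
  · rw [gluingStarIso_hom_app_left_snd, gluingStarIsoCan_hom_app_left_snd]

/-- Hence the 2-cells agree: `twoIso = twoIsoCan`. [cite: MochizukiSemiAnbd2006, Def. 2.2(i) p.23] -/
theorem twoIso_eq_twoIsoCan (bc : A.fibreData.total.Branch) (vc : A.fibreData.total.Vertex)
    (h : A.fibreData.total.abuts bc = some vc) : A.twoIso bc vc h = A.twoIsoCan bc vc h := by
  unfold twoIso twoIsoCan
  rw [gluingStarIso_eq_gluingStarIsoCan]

/-- **`coveringHomCan A = coveringHom A`**: the two presentations of the covering `𝒢_A → 𝒢` are the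
same morphism of semi-graphs of anabelioids. [cite: MochizukiSemiAnbd2006, Def. 2.2(i) p.23] -/
theorem coveringHomCan_eq_coveringHom : A.coveringHomCan = A.coveringHom := by
  unfold coveringHomCan coveringHom
  congr 1
  funext bc vc h
  exact (A.twoIso_eq_twoIsoCan bc vc h).symm

end BObj

end SemiGraphOfAnabelioids

end Literature.AnabelianGeometry.SemiGraphs
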